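import Mathlib
import Summits.Ventures.PercRepro2.RootPairSep

/-!
# Parallel reduction: two parallel edges are one edge
(blind cell PercRepro2, mine-2 g21; proofs/MINE2-CUTU.md Lemma 11.4 «2-terminal pieces = edges», the
parallel case; the series case is `SeriesReduction.lean`; this file is independent of it).

Let `e₁` and `e₂` be two edges with the same ends `{x, y}`.  Closing `e₂` and opening `e₁` whenever
one of the two was open does not change any connection (`conn_parallel`), so for every event of the
connectivity relation the probability under `p` equals the probability under the weights
`p' e₁ = p e₁ + p e₂ − p e₁ * p e₂`, `p' e₂ = 0` (`prob_parallel`; assembled with the pin identity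
`prob_eq_pin` as in the series case).  Together with `prob_series` every unmarked series-parallel
two-terminal piece reduces to one edge.
-/

namespace Summit.Ventures.PercRepro2

namespace Series

open SepPair

section Graph

variable {V : Type*} {E : Type*} [DecidableEq E] {ends : E → Sym2 V} {e₁ e₂ : E} {x y : V}

/-- **Parallel edges.**  With `ends e₁ = ends e₂ = {x, y}`, the configuration with `e₂` closed and
`e₁` open iff one of the two was open has the same connections. -/
lemma conn_parallel (hne : e₁ ≠ e₂) (hends₁ : ends e₁ = s(x, y)) (hends₂ : ends e₂ = s(x, y))
    (ω : Config E) (u v : V) :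
    Conn ends ω u v ↔
      Conn ends (Function.update (Function.update ω e₁ (ω e₁ || ω e₂)) e₂ false) u v := by
  set ω' := Function.update (Function.update ω e₁ (ω e₁ || ω e₂)) e₂ false with hω'
  have hω'₁ : ω' e₁ = (ω e₁ || ω e₂) := by
    rw [hω', Function.update_of_ne hne, Function.update_self]
  have hω'₂ : ω' e₂ = false := by rw [hω', Function.update_self]
  have hother : ∀ e, e ≠ e₁ → e ≠ e₂ → ω' e = ω e := by
    intro e h₁ h₂
    rw [hω', Function.update_of_ne h₂, Function.update_of_ne h₁]
  constructor
  · intro h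
    let S : Set V := {z | Conn ends ω' u z}
    have huS : u ∈ S := conn_refl _ _ _
    have hclosed : ∀ e z z', ω e = true → ends e = s(z, z') → z ∈ S → z' ∈ S := by
      intro e z z' he hends hzS
      by_cases h₁ : e = e₁
      · rw [h₁] at he hends
        have ho : ω' e₁ = true := by rw [hω'₁, he, Bool.true_or]
        exact conn_trans hzS (conn_of_openAdj ⟨e₁, ho, hends⟩)
      · by_cases h₂ : e = e₂
        · rw [h₂] at he hends
          have ho : ω' e₁ = true := by rw [hω'₁, he, Bool.or_true]
          rw [hends₂, ← hends₁] at hends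
          exact conn_trans hzS (conn_of_openAdj ⟨e₁, ho, hends⟩)
        · have he' : ω' e = true := by rw [hother e h₁ h₂]; exact he
          exact conn_trans hzS (conn_of_openAdj ⟨e, he', hends⟩)
    exact mem_of_conn_of_closed' hclosed huS h
  · intro h
    let S : Set V := {z | Conn ends ω u z}
    have huS : u ∈ S := conn_refl _ _ _
    have hclosed : ∀ e z z', ω' e = true → ends e = s(z, z') → z ∈ S → z' ∈ S := by
      intro e z z' he hends hzS
      by_cases h₁ : e = e₁
      · rw [h₁] at he hends
        rw [hω'₁] at he
        rcases Bool.or_eq_true_iff.1 he with ho | ho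
        · exact conn_trans hzS (conn_of_openAdj ⟨e₁, ho, hends⟩)
        · rw [hends₁, ← hends₂] at hends
          exact conn_trans hzS (conn_of_openAdj ⟨e₂, ho, hends⟩)
      · by_cases h₂ : e = e₂
        · rw [h₂] at he
          rw [hω'₂] at he
          exact absurd he Bool.false_ne_true
        · have he' : ω e = true := by rw [hother e h₁ h₂] at he; exact he
          exact conn_trans hzS (conn_of_openAdj ⟨e, he', hends⟩)
    exact mem_of_conn_of_closed' hclosed huS h

end Graph

section Prob

variable {V : Type*} {E : Type*} [Fintype E] [DecidableEq E] {R : Type*} [CommRing R]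
  {ends : E → Sym2 V} {e₁ e₂ : E} {x y : V}

/-- **Parallel reduction.**  For every event of the connectivity relation, the probability under
`p` equals the probability under the weights `p' e₁ = p e₁ + p e₂ − p e₁ * p e₂`, `p' e₂ = 0`. -/
theorem prob_parallel (hne : e₁ ≠ e₂) (hends₁ : ends e₁ = s(x, y)) (hends₂ : ends e₂ = s(x, y))
    (p : E → R) (P : (V → V → Prop) → Prop) :
    prob p {ω | P (Conn ends ω)} =
      prob (Function.update (Function.update p e₁ (p e₁ + p e₂ - p e₁ * p e₂)) e₂ 0)
        {ω | P (Conn ends ω)} := by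
  have hne' : e₂ ≠ e₁ := hne.symm
  set X := {ω : Config E | P (Conn ends ω)} with hX
  -- the pointwise identification: `ω ∈ X ↔ ω[e₁ := ω e₁ || ω e₂][e₂ := false] ∈ X`
  have key : ∀ (a b : Bool),
      {ω : Config E | Function.update (Function.update ω e₁ a) e₂ b ∈ X} =
        {ω | Function.update (Function.update ω e₁ (a || b)) e₂ false ∈ X} := by
    intro a b
    ext ω
    simp only [hX, Set.mem_setOf_eq]
    have hrel : Conn ends (Function.update (Function.update ω e₁ a) e₂ b) =
        Conn ends (Function.update (Function.update ω e₁ (a || b)) e₂ false) := by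
      have e : Function.update (Function.update (Function.update (Function.update ω e₁ a) e₂ b) e₁
          (Function.update (Function.update ω e₁ a) e₂ b e₁ ||
            Function.update (Function.update ω e₁ a) e₂ b e₂)) e₂ false =
          Function.update (Function.update ω e₁ (a || b)) e₂ false := by
        rw [Function.update_of_ne hne, Function.update_self, Function.update_self]
        funext e
        by_cases h₂ : e = e₂
        · simp [h₂]
        · by_cases h₁ : e = e₁
          · simp [h₁, Function.update_of_ne hne]
          · simp [Function.update_of_ne h₁, Function.update_of_ne h₂]
      funext u v
      rw [← e]
      exact propext (conn_parallel hne hends₁ hends₂ _ u v)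
    rw [hrel]
  -- pinned probabilities as probabilities of updated events (as in `SeriesReduction.lean`)
  have pu1 : ∀ (q : E → R) (e : E) (A : Set (Config E)),
      prob (Function.update q e 1) A = prob q {ω | Function.update ω e true ∈ A} := by
    intro q e A
    rw [prob_eq_expect_indicator, prob_eq_expect_indicator, expect_update_one]
    rfl
  have pu0 : ∀ (q : E → R) (e : E) (A : Set (Config E)),
      prob (Function.update q e 0) A = prob q {ω | Function.update ω e false ∈ A} := by
    intro q e A
    rw [prob_eq_expect_indicator, prob_eq_expect_indicator, expect_update_zero]
    rfl
  have T : ∀ (a b : Bool),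
      prob (Function.update (Function.update p e₁ (if a then 1 else 0)) e₂ (if b then 1 else 0)) X =
        prob p {ω | Function.update (Function.update ω e₁ a) e₂ b ∈ X} := by
    intro a b
    cases a <;> cases b <;>
      simp only [Bool.false_eq_true, ↓reduceIte] <;>
      first
        | (rw [pu0, pu0]; rfl)
        | (rw [pu0, pu1]; rfl)
        | (rw [pu1, pu0]; rfl)
        | (rw [pu1, pu1]; rfl)
  have T11 := T true true
  have T10 := T true false
  have T01 := T false true
  have T00 := T false false
  simp only [Bool.false_eq_true, ↓reduceIte] at T11 T10 T01 T00
  rw [key true true, key false true] at *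
  simp only [Bool.true_or, Bool.false_or] at T11 T01
  -- the left side
  have L1 : prob (Function.update p e₁ 1) X =
      p e₂ * prob (Function.update (Function.update p e₁ 1) e₂ 1) X +
        (1 - p e₂) * prob (Function.update (Function.update p e₁ 1) e₂ 0) X := by
    have h := prob_eq_pin (Function.update p e₁ 1) X e₂
    rwa [Function.update_of_ne hne'] at h
  have L0 : prob (Function.update p e₁ 0) X =
      p e₂ * prob (Function.update (Function.update p e₁ 0) e₂ 1) X +
        (1 - p e₂) * prob (Function.update (Function.update p e₁ 0) e₂ 0) X := by
    have h := prob_eq_pin (Function.update p e₁ 0) X e₂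
    rwa [Function.update_of_ne hne'] at h
  have LHS : prob p X = p e₁ * (p e₂ * prob p {ω | Function.update (Function.update ω e₁ true) e₂ false ∈ X} +
        (1 - p e₂) * prob p {ω | Function.update (Function.update ω e₁ true) e₂ false ∈ X}) +
      (1 - p e₁) * (p e₂ * prob p {ω | Function.update (Function.update ω e₁ true) e₂ false ∈ X} +
        (1 - p e₂) * prob p {ω | Function.update (Function.update ω e₁ false) e₂ false ∈ X}) := by
    rw [prob_eq_pin p X e₁, L1, L0, T11, T10, T01, T00]
  -- the right side
  set p' := Function.update (Function.update p e₁ (p e₁ + p e₂ - p e₁ * p e₂)) e₂ 0 with hp'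
  have hp'₁ : p' e₁ = p e₁ + p e₂ - p e₁ * p e₂ := by
    rw [hp', Function.update_of_ne hne, Function.update_self]
  have hp'₂ : p' e₂ = 0 := by rw [hp', Function.update_self]
  have upd : ∀ a : R, Function.update (Function.update p' e₁ a) e₂ 0 =
      Function.update (Function.update p e₁ a) e₂ 0 := by
    intro a
    funext e
    by_cases h₂ : e = e₂
    · simp [h₂]
    · by_cases h₁ : e = e₁
      · simp [h₁, Function.update_of_ne hne]
      · simp [hp', Function.update_of_ne h₁, Function.update_of_ne h₂]
  have R1 : prob (Function.update p' e₁ 1) X =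
      prob p {ω | Function.update (Function.update ω e₁ true) e₂ false ∈ X} := by
    have h := prob_eq_pin (Function.update p' e₁ 1) X e₂
    rw [Function.update_of_ne hne', hp'₂, upd, T10] at h
    rw [h]; ring
  have R0 : prob (Function.update p' e₁ 0) X =
      prob p {ω | Function.update (Function.update ω e₁ false) e₂ false ∈ X} := by
    have h := prob_eq_pin (Function.update p' e₁ 0) X e₂
    rw [Function.update_of_ne hne', hp'₂, upd, T00] at h
    rw [h]; ring
  have RHS : prob p' X = (p e₁ + p e₂ - p e₁ * p e₂) *
        prob p {ω | Function.update (Function.update ω e₁ true) e₂ false ∈ X} +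
      (1 - (p e₁ + p e₂ - p e₁ * p e₂)) *
        prob p {ω | Function.update (Function.update ω e₁ false) e₂ false ∈ X} := by
    rw [prob_eq_pin p' X e₁, hp'₁, R1, R0]
  rw [LHS, RHS]
  ring

end Prob

end Series

end Summit.Ventures.PercRepro2
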